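import Summits.Ventures.YMGap.RobustBall.ErgodicAverages
import Summits.Ventures.YMGap.RobustBall.ThermodynamicVariance
import HarnessLib

/-!
# Venture YMGap, track ROBUST-BALL — TOOLS FOR THE BOX-SUM CENTRAL LIMIT THEOREM (translation-invariant states on the
# `ℤ^d` link configurations; the complex/real covariance reduction)

HONEST FRAMING. WHAT THIS IS: a venture file (cell `pub-ymgap`, track Y2 ROBUST-BALL, seat ds-3, theorems only): small measure-
theoretic lemmas used by the object «C-CLT» (`BoxSumCLT.lean`), kept separate so that every import of that file is built:
* `configShift_add` — `θ_{y+z} = θ_y ∘ θ_z` on the link configurations; `identDistrib_comp_configShift` — under a translation-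
  invariant `μ`, `g ∘ θ_v` and `g ∘ θ_w` are identically distributed; `integral_sq_comp_configShift` — `∫ (g∘θ_v)² dμ = ∫ g² dμ`;
* `integral_abs_le_sqrt_integral_sq` — `E|X| ≤ √(E[X²])` for bounded measurable `X` (the variance of `|X|` is nonnegative);
* `integral_ofReal_add_ofReal_mul_I` — `∫ (p + i r) = ∫p + i ∫r` for real integrable `p, r`;
* ★ `norm_integral_cexp_add_sub_le` — THE COMPLEX/REAL COVARIANCE REDUCTION:
  `‖E[e^{i(X+X')}] − E[e^{iX}]E[e^{iX'}]‖ ≤ |cov(cos X, cos X')| + |cov(sin X, sin X')| + |cov(cos X, sin X')| + |cov(sin X, cos X')|`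
  (Mathlib's `cov[·,·;μ]`), which turns the dependence defect of the Bernstein-block criterion into covariances of bounded
  `1`-Lipschitz functions of block sums — the currency of the cell's clustering theorems;
* `abs_sub_integral_le`, `covariance_centred` — centring a bounded observable keeps it bounded (`|f − μf| ≤ 2M`) and does not
  change its autocovariances.
WHAT THIS IS NOT: no limit theorem here; nothing about the continuum or the Clay problem.
References: folklore (P. Billingsley, *Probability and Measure*, §27).
-/

noncomputable section

open MeasureTheory ProbabilityTheory Filter Topology Complex Finset
open Literature.Probability.LatticeModels hiding configShift configShift_apply
open Literature.MathematicalPhysics.QuantumLattice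

namespace Summit.Ventures.YMGap.RobustBall

namespace BoxSumCLT

variable {d : ℕ} {G : Type*} [MeasurableSpace G]

/-! ### Shifts -/

/-- `θ_{y+z} U = θ_y (θ_z U)` for the link-configuration shifts `(θ_v U)(x, i) = U(x − v, i)`. [folklore] -/
theorem configShift_add (y z : Site d) (U : LGConfig d G) : configShift (y + z) U = configShift y (configShift z U) := by
  funext e
  simp only [configShift_apply]
  congr 1
  ext <;> simp [sub_add_eq_sub_sub]

/-- **Shifted copies of one observable are identically distributed** under a translation-invariant state. [folklore] -/
theorem identDistrib_comp_configShift {μ : Measure (LGConfig d G)} (hμ : IsZdTranslationInvariant μ) {E : Type*}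
    [MeasurableSpace E] {g : LGConfig d G → E} (hg : Measurable g) (v w : Site d) :
    IdentDistrib (fun U => g (configShift v U)) (fun U => g (configShift w U)) μ μ := by
  refine ⟨(hg.comp (configShift v).measurable).aemeasurable, (hg.comp (configShift w).measurable).aemeasurable, ?_⟩
  change μ.map (g ∘ configShift v) = μ.map (g ∘ configShift w)
  rw [← Measure.map_map hg (configShift v).measurable, ← Measure.map_map hg (configShift w).measurable, hμ v, hμ w]

/-- `∫ (g∘θ_v)² dμ = ∫ g² dμ` for a translation-invariant `μ`. [folklore] -/
theorem integral_sq_comp_configShift {μ : Measure (LGConfig d G)} (hμ : IsZdTranslationInvariant μ) (g : LGConfig d G → ℝ)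
    (v : Site d) : ∫ U, g (configShift v U) ^ 2 ∂μ = ∫ U, g U ^ 2 ∂μ :=
  ErgodicAverages.integral_comp_shift hμ (fun U => g U ^ 2) v

/-! ### `E|X| ≤ √E[X²]` -/

/-- **`E|X| ≤ √(E[X²])`** for a bounded a.e.-strongly-measurable `X` on a probability space (`Var(|X|) ≥ 0`). [folklore] -/
theorem integral_abs_le_sqrt_integral_sq {Ω : Type*} [MeasurableSpace Ω] {μ : Measure Ω} [IsProbabilityMeasure μ]
    {X : Ω → ℝ} (hX : AEStronglyMeasurable X μ) {C : ℝ} (hC : ∀ ω, |X ω| ≤ C) :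
    ∫ ω, |X ω| ∂μ ≤ Real.sqrt (∫ ω, X ω ^ 2 ∂μ) := by
  have hXa : AEStronglyMeasurable (fun ω => |X ω|) μ := hX.norm
  have hmem : MemLp (fun ω => |X ω|) 2 μ :=
    memLp_of_bounded (a := -C) (b := C) (Eventually.of_forall fun ω => by
      simp only [Set.mem_Icc]; exact ⟨by linarith [abs_nonneg (X ω), hC ω], hC ω⟩) hXa 2
  have hvar := variance_nonneg (fun ω => |X ω|) μ
  rw [variance_eq_sub hmem] at hvar
  have hsq : ∫ ω, X ω ^ 2 ∂μ = μ[(fun ω => |X ω|) ^ 2] := by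
    congr 1; funext ω; simp [sq_abs]
  refine Real.le_sqrt_of_sq_le ?_
  rw [hsq]
  linarith

/-! ### Complex integrals of real and imaginary parts -/

/-- `∫ (p + i r) dμ = ∫ p dμ + i ∫ r dμ` for real integrable `p, r`. [folklore] -/
theorem integral_ofReal_add_ofReal_mul_I {Ω : Type*} [MeasurableSpace Ω] {μ : Measure Ω} {p r : Ω → ℝ}
    (hp : Integrable p μ) (hr : Integrable r μ) :
    ∫ ω, ((p ω : ℂ) + (r ω : ℂ) * I) ∂μ = ((∫ ω, p ω ∂μ : ℝ) : ℂ) + ((∫ ω, r ω ∂μ : ℝ) : ℂ) * I := by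
  have h1 : Integrable (fun ω => (p ω : ℂ)) μ := hp.ofReal
  have h2 : Integrable (fun ω => (r ω : ℂ) * I) μ := hr.ofReal.mul_const I
  have hsum : ∫ ω, ((p ω : ℂ) + (r ω : ℂ) * I) ∂μ = (∫ ω, (p ω : ℂ) ∂μ) + ∫ ω, (r ω : ℂ) * I ∂μ := integral_add h1 h2
  have hI : ∫ ω, (r ω : ℂ) * I ∂μ = (∫ ω, (r ω : ℂ) ∂μ) * I := integral_mul_const I _
  rw [hsum, hI, integral_complex_ofReal, integral_complex_ofReal]

/-- `e^{ix} = cos x + i sin x` with real casts. [folklore] -/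
theorem cexp_ofReal_mul_I (x : ℝ) : cexp ((x : ℂ) * I) = (Real.cos x : ℂ) + (Real.sin x : ℂ) * I := by
  rw [Complex.exp_mul_I, ← Complex.ofReal_cos, ← Complex.ofReal_sin]

/-- ★ **THE COMPLEX/REAL COVARIANCE REDUCTION.** For measurable real `X, X'` on a probability space:
`‖E[e^{i(X+X')}] − E[e^{iX}]·E[e^{iX'}]‖ ≤ |cov(cos X, cos X')| + |cov(sin X, sin X')| + |cov(cos X, sin X')| + |cov(sin X, cos X')|`.
[folklore] -/
theorem norm_integral_cexp_add_sub_le {Ω : Type*} [MeasurableSpace Ω] {μ : Measure Ω} [IsProbabilityMeasure μ]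
    {X X' : Ω → ℝ} (hX : Measurable X) (hX' : Measurable X') :
    ‖(∫ ω, cexp (((X ω + X' ω : ℝ) : ℂ) * I) ∂μ) -
        (∫ ω, cexp (((X ω : ℝ) : ℂ) * I) ∂μ) * ∫ ω, cexp (((X' ω : ℝ) : ℂ) * I) ∂μ‖ ≤
      |cov[fun ω => Real.cos (X ω), fun ω => Real.cos (X' ω); μ]| +
        |cov[fun ω => Real.sin (X ω), fun ω => Real.sin (X' ω); μ]| +
        |cov[fun ω => Real.cos (X ω), fun ω => Real.sin (X' ω); μ]| +
        |cov[fun ω => Real.sin (X ω), fun ω => Real.cos (X' ω); μ]| := by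
  -- the product of the two phases, in real and imaginary parts (before naming the four observables)
  have hprod : ∀ ω, cexp (((X ω + X' ω : ℝ) : ℂ) * I) =
      ((Real.cos (X ω) * Real.cos (X' ω) - Real.sin (X ω) * Real.sin (X' ω) : ℝ) : ℂ) +
        ((Real.cos (X ω) * Real.sin (X' ω) + Real.sin (X ω) * Real.cos (X' ω) : ℝ) : ℂ) * I := by
    intro ω
    rw [show ((X ω + X' ω : ℝ) : ℂ) * I = (X ω : ℂ) * I + (X' ω : ℂ) * I by push_cast; ring, Complex.exp_add,
      cexp_ofReal_mul_I, cexp_ofReal_mul_I]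
    push_cast
    ring_nf
    rw [Complex.I_sq]
    ring
  -- the four bounded real observables
  set c : Ω → ℝ := fun ω => Real.cos (X ω) with hc
  set s : Ω → ℝ := fun ω => Real.sin (X ω) with hs
  set c' : Ω → ℝ := fun ω => Real.cos (X' ω) with hc'
  set s' : Ω → ℝ := fun ω => Real.sin (X' ω) with hs'
  have hcm : Measurable c := Real.measurable_cos.comp hX
  have hsm : Measurable s := Real.measurable_sin.comp hX
  have hc'm : Measurable c' := Real.measurable_cos.comp hX'
  have hs'm : Measurable s' := Real.measurable_sin.comp hX'
  have hbd : ∀ {g : Ω → ℝ}, Measurable g → (∀ ω, |g ω| ≤ 1) → MemLp g 2 μ := fun hg hb =>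
    memLp_of_bounded (a := -1) (b := 1) (Eventually.of_forall fun ω => by
      simp only [Set.mem_Icc]; exact abs_le.1 (hb ω)) hg.aestronglyMeasurable 2
  have hc2 : MemLp c 2 μ := hbd hcm fun ω => Real.abs_cos_le_one _
  have hs2 : MemLp s 2 μ := hbd hsm fun ω => Real.abs_sin_le_one _
  have hc'2 : MemLp c' 2 μ := hbd hc'm fun ω => Real.abs_cos_le_one _
  have hs'2 : MemLp s' 2 μ := hbd hs'm fun ω => Real.abs_sin_le_one _
  have hi1 : ∀ {g : Ω → ℝ}, MemLp g 2 μ → Integrable g μ := fun hg => hg.integrable one_le_two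
  have hcc_i : Integrable (fun ω => c ω * c' ω) μ := hc2.integrable_mul hc'2
  have hss_i : Integrable (fun ω => s ω * s' ω) μ := hs2.integrable_mul hs'2
  have hcs_i : Integrable (fun ω => c ω * s' ω) μ := hc2.integrable_mul hs'2
  have hsc_i : Integrable (fun ω => s ω * c' ω) μ := hs2.integrable_mul hc'2
  have hp_i : Integrable (fun ω => c ω * c' ω - s ω * s' ω) μ := hcc_i.sub hss_i
  have hr_i : Integrable (fun ω => c ω * s' ω + s ω * c' ω) μ := hcs_i.add hsc_i
  have hE : ∫ ω, cexp (((X ω + X' ω : ℝ) : ℂ) * I) ∂μ =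
      ((∫ ω, (c ω * c' ω - s ω * s' ω) ∂μ : ℝ) : ℂ) + ((∫ ω, (c ω * s' ω + s ω * c' ω) ∂μ : ℝ) : ℂ) * I := by
    simp_rw [hprod]
    exact integral_ofReal_add_ofReal_mul_I hp_i hr_i
  have hE1 : ∫ ω, cexp (((X ω : ℝ) : ℂ) * I) ∂μ = ((∫ ω, c ω ∂μ : ℝ) : ℂ) + ((∫ ω, s ω ∂μ : ℝ) : ℂ) * I := by
    simp_rw [cexp_ofReal_mul_I]
    exact integral_ofReal_add_ofReal_mul_I (hi1 hc2) (hi1 hs2)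
  have hE2 : ∫ ω, cexp (((X' ω : ℝ) : ℂ) * I) ∂μ = ((∫ ω, c' ω ∂μ : ℝ) : ℂ) + ((∫ ω, s' ω ∂μ : ℝ) : ℂ) * I := by
    simp_rw [cexp_ofReal_mul_I]
    exact integral_ofReal_add_ofReal_mul_I (hi1 hc'2) (hi1 hs'2)
  -- the four covariances in `∫fg − ∫f ∫g` form
  have hcc := covariance_eq_sub hc2 hc'2
  have hss := covariance_eq_sub hs2 hs'2
  have hcs := covariance_eq_sub hc2 hs'2
  have hsc := covariance_eq_sub hs2 hc'2
  simp only [Pi.mul_apply] at hcc hss hcs hsc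
  have hsub1 : ∫ ω, (c ω * c' ω - s ω * s' ω) ∂μ = (∫ ω, c ω * c' ω ∂μ) - ∫ ω, s ω * s' ω ∂μ := integral_sub hcc_i hss_i
  have hadd1 : ∫ ω, (c ω * s' ω + s ω * c' ω) ∂μ = (∫ ω, c ω * s' ω ∂μ) + ∫ ω, s ω * c' ω ∂μ := integral_add hcs_i hsc_i
  have hre : (∫ ω, (c ω * c' ω - s ω * s' ω) ∂μ) - ((∫ ω, c ω ∂μ) * (∫ ω, c' ω ∂μ) - (∫ ω, s ω ∂μ) * ∫ ω, s' ω ∂μ) =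
      cov[c, c'; μ] - cov[s, s'; μ] := by
    rw [hsub1, hcc, hss]; ring
  have him : (∫ ω, (c ω * s' ω + s ω * c' ω) ∂μ) - ((∫ ω, c ω ∂μ) * (∫ ω, s' ω ∂μ) + (∫ ω, s ω ∂μ) * ∫ ω, c' ω ∂μ) =
      cov[c, s'; μ] + cov[s, c'; μ] := by
    rw [hadd1, hcs, hsc]; ring
  rw [hE, hE1, hE2]
  set Pc := ∫ ω, (c ω * c' ω - s ω * s' ω) ∂μ
  set Pr := ∫ ω, (c ω * s' ω + s ω * c' ω) ∂μ
  set Ic := ∫ ω, c ω ∂μ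
  set Is := ∫ ω, s ω ∂μ
  set Ic' := ∫ ω, c' ω ∂μ
  set Is' := ∫ ω, s' ω ∂μ
  have hdiff : ((Pc : ℝ) : ℂ) + ((Pr : ℝ) : ℂ) * I - (((Ic : ℝ) : ℂ) + ((Is : ℝ) : ℂ) * I) * (((Ic' : ℝ) : ℂ) + ((Is' : ℝ) : ℂ) * I) =
      ((Pc - (Ic * Ic' - Is * Is') : ℝ) : ℂ) + ((Pr - (Ic * Is' + Is * Ic') : ℝ) : ℂ) * I := by
    push_cast
    ring_nf
    rw [Complex.I_sq]
    ring
  rw [hdiff, hre, him]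
  calc ‖((cov[c, c'; μ] - cov[s, s'; μ] : ℝ) : ℂ) + ((cov[c, s'; μ] + cov[s, c'; μ] : ℝ) : ℂ) * I‖
      ≤ ‖((cov[c, c'; μ] - cov[s, s'; μ] : ℝ) : ℂ)‖ + ‖((cov[c, s'; μ] + cov[s, c'; μ] : ℝ) : ℂ) * I‖ := norm_add_le _ _
    _ = |cov[c, c'; μ] - cov[s, s'; μ]| + |cov[c, s'; μ] + cov[s, c'; μ]| := by
        rw [norm_mul, Complex.norm_I, mul_one, Complex.norm_real, Complex.norm_real, Real.norm_eq_abs, Real.norm_eq_abs]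
    _ ≤ |cov[c, c'; μ]| + |cov[s, s'; μ]| + (|cov[c, s'; μ]| + |cov[s, c'; μ]|) :=
        add_le_add (abs_sub _ _) (abs_add_le _ _)
    _ = _ := by ring

/-- `y ↦ cos (y − θ)` is `1`-Lipschitz. [folklore] -/
theorem lipschitzWith_cos_sub (θ : ℝ) : LipschitzWith 1 fun y : ℝ => Real.cos (y - θ) :=
  LipschitzWith.of_dist_le_mul fun x y => by
    rw [Real.dist_eq, Real.dist_eq, NNReal.coe_one, one_mul]
    exact (Real.abs_cos_sub_cos_le _ _).trans (by rw [sub_sub_sub_cancel_right])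

/-- `y ↦ sin (y − θ)` is `1`-Lipschitz. [folklore] -/
theorem lipschitzWith_sin_sub (θ : ℝ) : LipschitzWith 1 fun y : ℝ => Real.sin (y - θ) :=
  LipschitzWith.of_dist_le_mul fun x y => by
    rw [Real.dist_eq, Real.dist_eq, NNReal.coe_one, one_mul]
    exact (Real.abs_sin_sub_sin_le _ _).trans (by rw [sub_sub_sub_cancel_right])

/-! ### Centring a bounded observable -/

/-- `|∫ f dμ| ≤ M` and `|f U − ∫ f dμ| ≤ 2M` for `|f| ≤ M` on a probability space. [folklore] -/
theorem abs_sub_integral_le {μ : Measure (LGConfig d G)} [IsProbabilityMeasure μ] {f : LGConfig d G → ℝ} {M : ℝ}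
    (hfb : ∀ U, |f U| ≤ M) (U : LGConfig d G) : |f U - ∫ V, f V ∂μ| ≤ 2 * M := by
  have hint : |∫ V, f V ∂μ| ≤ M := by
    have h := norm_integral_le_of_norm_le_const (μ := μ) (f := f) (C := M) (Eventually.of_forall fun V => by
      rw [Real.norm_eq_abs]; exact hfb V)
    simpa [Real.norm_eq_abs] using h
  calc |f U - ∫ V, f V ∂μ| ≤ |f U| + |∫ V, f V ∂μ| := abs_sub _ _
    _ ≤ M + M := add_le_add (hfb U) hint
    _ = 2 * M := by ring

/-- **Centring does not change the autocovariances**: `cov(f − a, (f − a)∘θ_v) = cov(f, f∘θ_v)` for bounded measurable `f` and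
any constant `a`. [folklore] -/
theorem covariance_centred {μ : Measure (LGConfig d G)} [IsProbabilityMeasure μ] {f : LGConfig d G → ℝ} (hfm : Measurable f)
    {M : ℝ} (hfb : ∀ U, |f U| ≤ M) (a : ℝ) (v : Site d) :
    cov[fun U => f U - a, fun U => f (configShift v U) - a; μ] = cov[f, fun U => f (configShift v U); μ] := by
  have hfi : Integrable f μ :=
    (integrable_const M).mono' hfm.aestronglyMeasurable (Eventually.of_forall fun U => by simpa [Real.norm_eq_abs] using hfb U)
  have hfvi : Integrable (fun U => f (configShift v U)) μ :=
    (integrable_const M).mono' (hfm.comp (configShift v).measurable).aestronglyMeasurable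
      (Eventually.of_forall fun U => by simpa [Real.norm_eq_abs] using hfb _)
  rw [covariance_sub_const_left hfi, covariance_sub_const_right hfvi]

/-! ### The dependence defect of two separated block families under a pair clustering bound -/

/-- **Defect of two separated families.** Under the PAIR CLUSTERING BOUND of `BoxSumCLT.tendstoInDistribution_boxSum` (for `f`, with
constants `R₀, m, A ≥ 0`): if `P, Q` are `D`-separated (`D ≥ R₀`) and `X = a Σ_{x∈P} f∘θ_x − a #P a₀`, `X' = a Σ_{y∈Q} f∘θ_y − a #Q a₀`
(centred, scaled block sums), then
`‖E[e^{i(X+X')}] − E[e^{iX}] E[e^{iX'}]‖ ≤ 4 A (#P + #Q)² (1 + a² #P #Q) e^{−m D}`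
(`norm_integral_cexp_add_sub_le` + the bound applied to the `1`-Lipschitz functions `cos(· − θ)`, `sin(· − θ)`). [folklore] -/
theorem norm_defect_le_of_pairClustering {μ : Measure (LGConfig d G)} [IsProbabilityMeasure μ] {f : LGConfig d G → ℝ}
    {R₀ mr A : ℝ}
    (hcl : ∀ (P Q : Finset (Site d)) (D a : ℝ) (φ ψ : ℝ → ℝ), R₀ ≤ D → (∀ x ∈ P, ∀ y ∈ Q, D ≤ ‖x - y‖) →
      LipschitzWith 1 φ → LipschitzWith 1 ψ → (∀ z, |φ z| ≤ 1) → (∀ z, |ψ z| ≤ 1) →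
      |cov[fun U => φ (a * ∑ x ∈ P, f (configShift x U)), fun U => ψ (a * ∑ y ∈ Q, f (configShift y U)); μ]| ≤
        A * ((P.card : ℝ) + Q.card) ^ 2 * (1 + a ^ 2 * P.card * Q.card) * Real.exp (-mr * D))
    {P Q : Finset (Site d)} {D : ℝ} (hD : R₀ ≤ D) (hPQ : ∀ x ∈ P, ∀ y ∈ Q, D ≤ ‖x - y‖) (a a₀ : ℝ)
    {X X' : LGConfig d G → ℝ} (hXm : Measurable X) (hX'm : Measurable X')
    (hX : ∀ U, X U = a * ∑ x ∈ P, f (configShift x U) - a * (P.card * a₀))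
    (hX' : ∀ U, X' U = a * ∑ x ∈ Q, f (configShift x U) - a * (Q.card * a₀)) :
    ‖(∫ U, cexp (((X U + X' U : ℝ) : ℂ) * I) ∂μ) -
        (∫ U, cexp (((X U : ℝ) : ℂ) * I) ∂μ) * ∫ U, cexp (((X' U : ℝ) : ℂ) * I) ∂μ‖ ≤
      4 * (A * ((P.card : ℝ) + Q.card) ^ 2 * (1 + a ^ 2 * P.card * Q.card) * Real.exp (-mr * D)) := by
  refine (norm_integral_cexp_add_sub_le hXm hX'm).trans ?_
  set B : ℝ := A * ((P.card : ℝ) + Q.card) ^ 2 * (1 + a ^ 2 * P.card * Q.card) * Real.exp (-mr * D) with hB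
  -- each covariance through the clustering hypothesis, with the shifted `cos`/`sin`
  have hcovb : ∀ (φ₀ ψ₀ : ℝ → ℝ), LipschitzWith 1 φ₀ → LipschitzWith 1 ψ₀ → (∀ y, |φ₀ y| ≤ 1) → (∀ y, |ψ₀ y| ≤ 1) →
      |cov[fun U => φ₀ (X U + a * (P.card * a₀)), fun U => ψ₀ (X' U + a * (Q.card * a₀)); μ]| ≤ B := by
    intro φ₀ ψ₀ hφ hψ hφb hψb
    have hfun1 : (fun U => φ₀ (X U + a * (P.card * a₀))) = fun U => φ₀ (a * ∑ x ∈ P, f (configShift x U)) := by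
      funext U; rw [hX]; ring_nf
    have hfun2 : (fun U => ψ₀ (X' U + a * (Q.card * a₀))) = fun U => ψ₀ (a * ∑ x ∈ Q, f (configShift x U)) := by
      funext U; rw [hX']; ring_nf
    rw [hfun1, hfun2]
    exact hcl P Q D a φ₀ ψ₀ hD hPQ hφ hψ hφb hψb
  have e1 : (fun U => Real.cos (X U)) = fun U => (fun y => Real.cos (y - a * (P.card * a₀))) (X U + a * (P.card * a₀)) :=
    funext fun U => by simp
  have e2 : (fun U => Real.sin (X U)) = fun U => (fun y => Real.sin (y - a * (P.card * a₀))) (X U + a * (P.card * a₀)) :=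
    funext fun U => by simp
  have e3 : (fun U => Real.cos (X' U)) = fun U => (fun y => Real.cos (y - a * (Q.card * a₀))) (X' U + a * (Q.card * a₀)) :=
    funext fun U => by simp
  have e4 : (fun U => Real.sin (X' U)) = fun U => (fun y => Real.sin (y - a * (Q.card * a₀))) (X' U + a * (Q.card * a₀)) :=
    funext fun U => by simp
  have hcb : ∀ θ y : ℝ, |Real.cos (y - θ)| ≤ 1 := fun θ y => Real.abs_cos_le_one _
  have hsb : ∀ θ y : ℝ, |Real.sin (y - θ)| ≤ 1 := fun θ y => Real.abs_sin_le_one _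
  set θ₁ : ℝ := a * (P.card * a₀)
  set θ₂ : ℝ := a * (Q.card * a₀)
  have b1 := hcovb (fun y => Real.cos (y - θ₁)) (fun y => Real.cos (y - θ₂)) (lipschitzWith_cos_sub _)
    (lipschitzWith_cos_sub _) (hcb _) (hcb _)
  have b2 := hcovb (fun y => Real.sin (y - θ₁)) (fun y => Real.sin (y - θ₂)) (lipschitzWith_sin_sub _)
    (lipschitzWith_sin_sub _) (hsb _) (hsb _)
  have b3 := hcovb (fun y => Real.cos (y - θ₁)) (fun y => Real.sin (y - θ₂)) (lipschitzWith_cos_sub _)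
    (lipschitzWith_sin_sub _) (hcb _) (hsb _)
  have b4 := hcovb (fun y => Real.sin (y - θ₁)) (fun y => Real.cos (y - θ₂)) (lipschitzWith_sin_sub _)
    (lipschitzWith_cos_sub _) (hsb _) (hcb _)
  rw [e1, e2, e3, e4]
  linarith

/-! ### Summable autocovariance from the pair clustering bound -/

/-- `|cov(X, Y)| ≤ 2C²` for `|X|, |Y| ≤ C` measurable on a probability space. [folklore] -/
theorem abs_covariance_le_two_mul_sq {Ω : Type*} [MeasurableSpace Ω] {μ : Measure Ω} [IsProbabilityMeasure μ] {X Y : Ω → ℝ}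
    (hX : Measurable X) (hY : Measurable Y) {C : ℝ} (hXb : ∀ ω, |X ω| ≤ C) (hYb : ∀ ω, |Y ω| ≤ C) :
    |cov[X, Y; μ]| ≤ 2 * C ^ 2 := by
  have hC : 0 ≤ C := by
    by_contra h
    have := hXb (Classical.choice (nonempty_of_isProbabilityMeasure μ))
    linarith [abs_nonneg (X (Classical.choice (nonempty_of_isProbabilityMeasure μ)))]
  have hmem : ∀ {Z : Ω → ℝ}, Measurable Z → (∀ ω, |Z ω| ≤ C) → MemLp Z 2 μ := fun hZ hb =>
    memLp_of_bounded (a := -C) (b := C) (Eventually.of_forall fun ω => by simp only [Set.mem_Icc]; exact abs_le.1 (hb ω))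
      hZ.aestronglyMeasurable 2
  rw [covariance_eq_sub (hmem hX hXb) (hmem hY hYb)]
  have h1 : |∫ ω, (X * Y) ω ∂μ| ≤ C ^ 2 := by
    have h := norm_integral_le_of_norm_le_const (μ := μ) (f := fun ω => (X * Y) ω) (C := C ^ 2)
      (Eventually.of_forall fun ω => by
        rw [Pi.mul_apply, Real.norm_eq_abs, abs_mul, sq]; exact mul_le_mul (hXb ω) (hYb ω) (abs_nonneg _) hC)
    simpa [Real.norm_eq_abs] using h
  have h2 : |∫ ω, X ω ∂μ| ≤ C := by
    have h := norm_integral_le_of_norm_le_const (μ := μ) (f := X) (C := C) (Eventually.of_forall fun ω => by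
      rw [Real.norm_eq_abs]; exact hXb ω)
    simpa [Real.norm_eq_abs] using h
  have h3 : |∫ ω, Y ω ∂μ| ≤ C := by
    have h := norm_integral_le_of_norm_le_const (μ := μ) (f := Y) (C := C) (Eventually.of_forall fun ω => by
      rw [Real.norm_eq_abs]; exact hYb ω)
    simpa [Real.norm_eq_abs] using h
  calc |∫ ω, (X * Y) ω ∂μ - (∫ ω, X ω ∂μ) * ∫ ω, Y ω ∂μ| ≤ |∫ ω, (X * Y) ω ∂μ| + |(∫ ω, X ω ∂μ) * ∫ ω, Y ω ∂μ| := abs_sub _ _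
    _ ≤ C ^ 2 + C * C := by rw [abs_mul]; exact add_le_add h1 (mul_le_mul h2 h3 (abs_nonneg _) hC)
    _ = 2 * C ^ 2 := by ring

/-- **Summable autocovariance from the pair clustering bound**: under the PAIR CLUSTERING BOUND of `BoxSumCLT.tendstoInDistribution_boxSum`
(`d ≥ 1`, `m > 0`, `A ≥ 0`), a bounded measurable `f` has `Σ_v |cov_μ(f, f∘θ_v)| < ∞` — apply the bound to the clamped, rescaled
observable at `P = {0}`, `Q = {v}` and compare with `C e^{−m‖v‖}` (rb-p1's `ℓ¹` lattice sum via `ThermodynamicVariance.summable_abs_of_exp_decay`).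
[folklore] -/
theorem summable_abs_cov_of_pairClustering (hd : 1 ≤ d) {μ : Measure (LGConfig d G)} [IsProbabilityMeasure μ]
    {f : LGConfig d G → ℝ} (hfm : Measurable f) {M : ℝ} (hfb : ∀ U, |f U| ≤ M) {R₀ mr A : ℝ} (hmr : 0 < mr) (hA : 0 ≤ A)
    (hcl : ∀ (P Q : Finset (Site d)) (D a : ℝ) (φ ψ : ℝ → ℝ), R₀ ≤ D → (∀ x ∈ P, ∀ y ∈ Q, D ≤ ‖x - y‖) →
      LipschitzWith 1 φ → LipschitzWith 1 ψ → (∀ z, |φ z| ≤ 1) → (∀ z, |ψ z| ≤ 1) →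
      |cov[fun U => φ (a * ∑ x ∈ P, f (configShift x U)), fun U => ψ (a * ∑ y ∈ Q, f (configShift y U)); μ]| ≤
        A * ((P.card : ℝ) + Q.card) ^ 2 * (1 + a ^ 2 * P.card * Q.card) * Real.exp (-mr * D)) :
    Summable fun v : Site d => |cov[f, fun U => f (configShift v U); μ]| := by
  set C : ℝ := max M 1 with hCdef
  have hC1 : 1 ≤ C := le_max_right _ _
  have hC0 : 0 < C := by linarith
  have hfC : ∀ U, |f U| ≤ C := fun U => (hfb U).trans (le_max_left _ _)
  -- the clamp `φ y = max (-1) (min 1 y)`: `1`-Lipschitz, bounded by `1`, the identity on `[-1, 1]`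
  set φ : ℝ → ℝ := fun y => max (-1) (min 1 y) with hφ
  have hφL : LipschitzWith 1 φ := (LipschitzWith.id.const_min 1).const_max (-1)
  have hφb : ∀ y, |φ y| ≤ 1 := fun y => abs_le.2 ⟨le_max_left _ _, max_le (by norm_num) (min_le_left _ _)⟩
  have hφid : ∀ y, |y| ≤ 1 → φ y = y := fun y hy => by
    obtain ⟨h1, h2⟩ := abs_le.1 hy
    simp only [hφ, min_eq_right h2, max_eq_right h1]
  have hscale : ∀ U, φ (1 / C * f U) = 1 / C * f U := fun U => hφid _ (by
    rw [abs_mul, abs_of_pos (by positivity), one_div, inv_mul_le_iff₀ hC0, mul_one]; exact hfC U)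
  -- far range: the clustering bound at `P = {0}`, `Q = {v}`
  have hfar : ∀ v : Site d, R₀ ≤ ‖v‖ → |cov[f, fun U => f (configShift v U); μ]| ≤ 8 * A * C ^ 2 * Real.exp (-mr * ‖v‖) := by
    intro v hv
    have h := hcl {0} {v} ‖v‖ (1 / C) φ φ hv (fun x hx y hy => by
      rw [Finset.mem_singleton] at hx hy; rw [hx, hy, zero_sub, norm_neg]) hφL hφL hφb hφb
    have e1 : (fun U => φ (1 / C * ∑ x ∈ ({0} : Finset (Site d)), f (configShift x U))) = fun U => 1 / C * f U := by
      funext U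
      have h0 : configShift (0 : Site d) U = U := by funext e; simp [configShift_apply]
      rw [Finset.sum_singleton, h0]; exact hscale U
    have e2 : (fun U => φ (1 / C * ∑ x ∈ ({v} : Finset (Site d)), f (configShift x U))) =
        fun U => 1 / C * f (configShift v U) := by
      funext U; rw [Finset.sum_singleton]; exact hscale _
    rw [e1, e2, covariance_const_mul_left, covariance_const_mul_right] at h
    simp only [Finset.card_singleton, Nat.cast_one] at h
    have hcov : |cov[f, fun U => f (configShift v U); μ]| =
        C ^ 2 * |1 / C * (1 / C * cov[f, fun U => f (configShift v U); μ])| := by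
      rw [abs_mul, abs_mul, abs_of_pos (by positivity : (0 : ℝ) < 1 / C)]; field_simp
    rw [hcov]
    have hinv : (1 / C) ^ 2 ≤ 1 := by
      rw [div_pow, one_pow, div_le_one (by positivity)]; nlinarith
    calc C ^ 2 * |1 / C * (1 / C * cov[f, fun U => f (configShift v U); μ])|
        ≤ C ^ 2 * (A * ((1 : ℝ) + 1) ^ 2 * (1 + (1 / C) ^ 2 * 1 * 1) * Real.exp (-mr * ‖v‖)) :=
          mul_le_mul_of_nonneg_left h (sq_nonneg _)
      _ ≤ C ^ 2 * (A * ((1 : ℝ) + 1) ^ 2 * (1 + 1) * Real.exp (-mr * ‖v‖)) := by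
          gcongr; simpa using hinv
      _ = 8 * A * C ^ 2 * Real.exp (-mr * ‖v‖) := by ring
  -- all ranges
  set R₁ : ℝ := max R₀ 0 with hR₁
  have hbound : ∀ v : Site d, |cov[f, fun U => f (configShift v U); μ]| ≤
      (8 * A * C ^ 2 + 2 * C ^ 2 * Real.exp (mr * R₁)) * Real.exp (-mr * ‖v‖) := by
    intro v
    have hnear : |cov[f, fun U => f (configShift v U); μ]| ≤ 2 * C ^ 2 :=
      abs_covariance_le_two_mul_sq hfm (hfm.comp (configShift v).measurable) hfC (fun U => hfC _)
    have hpos1 : 0 ≤ 8 * A * C ^ 2 * Real.exp (-mr * ‖v‖) := by positivity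
    have hpos2 : 0 ≤ 2 * C ^ 2 * Real.exp (mr * R₁) * Real.exp (-mr * ‖v‖) := by positivity
    by_cases hv : R₁ ≤ ‖v‖
    · have h := hfar v ((le_max_left _ _).trans hv)
      nlinarith
    · have hv := not_le.mp hv
      have hexp : (1 : ℝ) ≤ Real.exp (mr * R₁) * Real.exp (-mr * ‖v‖) := by
        rw [← Real.exp_add]; exact Real.one_le_exp (by nlinarith)
      nlinarith
  exact ThermodynamicVariance.summable_abs_of_exp_decay hd hmr hbound

end BoxSumCLT

end Summit.Ventures.YMGap.RobustBall

end
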